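import Literature.NumberTheory.Automorphic.ArchEndoscopicDiagonalCongruence     -- ★ (R3-a) p841011: the 2-block congruence, `IsArchStablyConjH` carriers (★ `ArchimedeanTransfer`)
import Literature.NumberTheory.Automorphic.ArchEndoscopicCentralDescent          -- ★ (R3-f)2b p841432: `injective_of_apply_zero_ne_apply_one`, `comp_swap_apply_zero_ne` (the flip convention)
import Literature.NumberTheory.Automorphic.ArchStableClassRegularTorus           -- ★ (V8)-glob p838902: `isConj_archDiagTorus_iff_exists`, `exists_isConj_archDiagTorus_of_isStablyConj`, `archPiEquivCM_archDiagTorus`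
import Literature.NumberTheory.Rogawski1990.StableClassHRegrouping               -- ★ (G3)-H: `isConj_prod_iff` (conjugacy in `U(J₂) × U(J₁)` is componentwise)
import HarnessLib

/-!
# The conjugacy classes of `H_∞ = U(Φ₂)(L ⊗ ℝ) × U(Φ₁)(L ⊗ ℝ)` inside the stable class of a regular torus point are EXACTLY the `2^{#W}` flips
# (Rogawski 1990 §3.7 Prop. 3.7.1, §4.9 p. 54, §14.3 p. 234; the class bookkeeping of Lemma 14.5.2 (c) at `∞`)

Topic `NumberTheory/Automorphic`; namespace `Literature.NumberTheory.Automorphic.UnitaryGroup`.  THEOREMS ONLY (no `def`, no instance, no notation, no axiom, no named fact, no `sorry`).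
Cell `pub/hodgecm-mathlib`, ENGINE T1 (crux H413 = `stmt-HodgeConjecture-24833`); ROAD-Sd residual R3 «(S-c) central vanishing» (`stub_ScCore` of `Cruxes/H413/Lines/F0_P3a_SdArch.lean`), brick
**(3H) «H-SIDE CLASS BOOKKEEPING»**, FILE A (group theory) of two (`ArchEndoscopicStableSumTorus` = FILE B, the Haar-currency identity); STEP-3 integration map
`CENSUS-R3-STEP3-Integration.F0P3a-p03g10.md` b54b3c40 (pen of record F0P3a-p03 (g10); LEAD WORDS T8-76 (C), T8-79 (1), T8-80); author F0P3a-p02 (g11), 2026-09-01.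

WHY.  ★ `ArchDeltaTransferHaarForm` ((E1), p841341) reads (vi) at a `G`-regular `γ_H` in HAAR currency with `H`-side `∑ᶠ_{c : γ_H ∼st out c} ∫_{H_∞} aH(h·out c·h⁻¹) dνH(h)`, a `finsum`
over the conjugacy classes `c` of `H_∞` inside the STABLE class of `γ_H`.  For `γ_H = (ψ⁻¹ t(u), δ)` — `ψ : U(Φ₂)_∞ ≃ₜ* U(diag α)_∞` a congruence conjugating by some `T ∈ GL₂(L ⊗ ℝ)`
(★ (R3-a): `Φ₂ = c(Q₂)ᵀ·diag(½,−½)·Q₂`), `t(u)` a REGULAR diagonal torus point (`u_w 0 ≠ u_w 1` at every complex place `w`), `δ` ANY element of the abelian factor — these classes are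
exactly the classes of the `2^{#W}` flipped points `(ψ⁻¹ t(u^ε), δ)`, `ε : W → Bool`, `u_w^{tt} = u_w ∘ swap`, and they are pairwise distinct: stable conjugacy in `H_∞` is componentwise
`GL`-conjugacy (★ `IsStablyConjH`); on the 2-block ★ (V8) lists the stable class of a regular torus point as the relabellings and a conjugacy INSIDE `U(diag α)_∞` preserves, place by
place, the signs `re σ_w(α_i)` of the eigenlines — OPPOSITE here (`hsgn`: the 2-block is a `U(1,1)` at every place), so no flip is a conjugacy; on the 1-block `GL₁` is commutative, so a
stable conjugate has the SAME `U(Φ₁)`-component.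

WHAT IS PROVED.
§1 small group facts: `eq_of_isConj_gl_fin_one` (`GL₁` is commutative: conjugate = equal), `perm_fin_two_eq_one_or_eq_swap` (`S₂ = {1, (0 1)}`),
   `comp_ite_swap_eq` (★ (E2)'s flip convention `u ∘ ρ^ε`); conjugacy in the product `H_∞` is componentwise by ★ `isConj_prod_iff` (`StableClassHRegrouping`).
§2 `isConj_coe_iff_isConj_coe_congr` (`GL`-conjugacy of 2-blocks read through `ψ`), `isArchStablyConjH_iff_isConj_coe`, `archDiagTorus_eq_symm_apply` (`t(z) = e⁻¹(w ↦ diag z_w)`),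
   **`setOf_isArchStablyConjH_out_eq_range`** — `{c | (ψ⁻¹ t(u), δ) ∼st out c} = range (ε ↦ ⟦(ψ⁻¹ t(u^ε), δ)⟧)`, and **`injective_conjClassesMk_flip`** — the `2^{#W}` classes are distinct.
USE: FILE B `ArchEndoscopicStableSumTorus` turns (E1)'s `finsum` into `Σ_{ε : W → Bool}` (`finsum_mem_range` + these two) and then into ★ (E2)'s symmetrised product orbital integral.
HONEST LABEL: HC_CM is proved only modulo the 7 printed citations until rung 0 closes; this file is group-theoretic bookkeeping and pays nothing by itself.

## References
* [Rogawski1990] J. D. Rogawski, *Automorphic Representations of Unitary Groups in Three Variables*, Ann. of Math. Stud. 123 (1990), §3.1 p. 19, §3.7 Prop. 3.7.1 pp. 29–30 (classes in a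
  stable class), §4.9 p. 54 (`H = U(2) × U(1)`), §14.3 p. 234 (`H_∞`), §14.5 Lemma 14.5.2 (c) p. 238.
* [BorelJacquet1979] A. Borel, H. Jacquet, *Automorphic forms and automorphic representations*, PSPM 33.1 (1979), §4.1 (`G_∞ = Π_v G_v`).
* [BrockerTomDieck1985] Th. Bröcker, T. tom Dieck, *Representations of Compact Lie Groups*, GTM 98 (1985), Ch. IV (3.2) (Weyl groups of compact tori).
* [PlatonovRapinchuk1994] V. Platonov, A. Rapinchuk, *Algebraic Groups and Number Theory* (1994), §2.3 (congruent forms, conjugate unitary groups).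
-/

set_option autoImplicit false

noncomputable section

open MeasureTheory Measure Filter Topology NumberField NumberField.InfinitePlace NumberField.mixedEmbedding Set Function
open Literature.MeasureTheory.Group Literature.NumberTheory.Rogawski1990
open scoped Matrix MatrixGroups NNReal ENNReal ComplexOrder

namespace Literature.NumberTheory.Automorphic

namespace UnitaryGroup

/-! ## §1 Small group facts -/

section Small

/-- In `GL₁` over a commutative ring, conjugate elements are EQUAL (`GL₁` is commutative, ★ `GL_fin_one_mul_comm` ∕ ★ `commute_gl_fin_one`; for `U(1)` «both notions are equality»,
★ `isConj_iff_eq_unitaryGroup_fin_one` — here on the ambient `GL₁` where ★ `IsStablyConjH` reads the 1-block). [cite: Rogawski1990, §3.1 p. 19; §4.9 p. 54] -/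
theorem eq_of_isConj_gl_fin_one {R : Type*} [CommRing R] {x y : GL (Fin 1) R} (h : IsConj x y) : x = y := by
  obtain ⟨c, hc⟩ := isConj_iff.1 h
  have hcomm : c * x = x * c := by
    apply Units.ext
    ext i j
    rw [Units.val_mul, Units.val_mul, Matrix.mul_apply, Matrix.mul_apply, Fin.sum_univ_one, Fin.sum_univ_one,
      Subsingleton.elim i 0, Subsingleton.elim j 0, mul_comm]
  rw [← hc, hcomm, mul_inv_cancel_right]

/-- `S₂ = {1, (0 1)}`. [cite: Rogawski1990, §3.7 Prop. 3.7.1 pp. 29–30] -/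
theorem perm_fin_two_eq_one_or_eq_swap (ρ : Equiv.Perm (Fin 2)) : ρ = 1 ∨ ρ = Equiv.swap 0 1 := by
  revert ρ
  decide

/-- The flip convention of ★ (E2): `u ∘ ρ^ε = if ε then u ∘ swap else u` for `ρ^ε = if ε then swap else 1`. [cite: Rogawski1990, §14.5 p. 238] -/
theorem comp_ite_swap_eq {β : Type*} (u : Fin 2 → β) (b : Bool) :
    (u ∘ ⇑(if b then Equiv.swap (0 : Fin 2) 1 else (1 : Equiv.Perm (Fin 2)))) = (if b then u ∘ ⇑(Equiv.swap (0 : Fin 2) 1) else u) := by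
  cases b <;> rfl

end Small

/-! ## §2 The classes of `H_∞` inside the stable class of a regular torus point: exactly the `2^{#W}` flips -/

section Classes

variable (L : Type) [Field L] [NumberField L] [IsCMField L] (α : Fin 2 → L)
  (T : GL (Fin 2) (mixedSpace L))
  (ψ : arch (↥(maximalRealSubfield L)) L (IsCMField.complexConj L) 2 (Matrix.of fun i j : Fin 2 => if i.val + j.val + 1 = 2 then (1 : L) else 0) ≃ₜ*
    arch (↥(maximalRealSubfield L)) L (IsCMField.complexConj L) 2 (Matrix.diagonal α))
  (hψ : ∀ x, ((ψ x : arch (↥(maximalRealSubfield L)) L (IsCMField.complexConj L) 2 (Matrix.diagonal α)) : GL (Fin 2) (mixedSpace L)) =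
    T * (x : GL (Fin 2) (mixedSpace L)) * T⁻¹)

include hψ in
/-- **`GL₂(L ⊗ ℝ)`-conjugacy of 2-blocks is read through `ψ`** (which conjugates by `T`): `x ∼_{GL} y ↔ ψ x ∼_{GL} ψ y` (★ (R3-a) `hconjT` pattern). [cite: Rogawski1990, §3.1 p. 19]
[cite: PlatonovRapinchuk1994, §2.3] -/
theorem isConj_coe_iff_isConj_coe_congr
    (x y : arch (↥(maximalRealSubfield L)) L (IsCMField.complexConj L) 2 (Matrix.of fun i j : Fin 2 => if i.val + j.val + 1 = 2 then (1 : L) else 0)) :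
    IsConj (x : GL (Fin 2) (mixedSpace L)) (y : GL (Fin 2) (mixedSpace L)) ↔
      IsConj ((ψ x : arch (↥(maximalRealSubfield L)) L (IsCMField.complexConj L) 2 (Matrix.diagonal α)) : GL (Fin 2) (mixedSpace L))
        ((ψ y : arch (↥(maximalRealSubfield L)) L (IsCMField.complexConj L) 2 (Matrix.diagonal α)) : GL (Fin 2) (mixedSpace L)) := by
  rw [hψ x, hψ y, isConj_iff, isConj_iff]
  constructor
  · rintro ⟨c, hc⟩
    refine ⟨T * c * T⁻¹, ?_⟩
    rw [← hc]
    group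
  · rintro ⟨c, hc⟩
    refine ⟨T⁻¹ * c * T, ?_⟩
    have h2 : T⁻¹ * (c * (T * (x : GL (Fin 2) (mixedSpace L)) * T⁻¹) * c⁻¹) * T = T⁻¹ * (T * (y : GL (Fin 2) (mixedSpace L)) * T⁻¹) * T := by rw [hc]
    calc T⁻¹ * c * T * (x : GL (Fin 2) (mixedSpace L)) * (T⁻¹ * c * T)⁻¹
        = T⁻¹ * (c * (T * (x : GL (Fin 2) (mixedSpace L)) * T⁻¹) * c⁻¹) * T := by group
      _ = T⁻¹ * (T * (y : GL (Fin 2) (mixedSpace L)) * T⁻¹) * T := h2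
      _ = (y : GL (Fin 2) (mixedSpace L)) := by group

/-- `IsArchStablyConjH` unfolded: componentwise `GL`-conjugacy of the underlying invertible matrices (★ `IsStablyConjH`). [cite: Rogawski1990, §3.1 p. 19] -/
theorem isArchStablyConjH_iff_isConj_coe
    (a b : arch (↥(maximalRealSubfield L)) L (IsCMField.complexConj L) 2 (Matrix.of fun i j : Fin 2 => if i.val + j.val + 1 = 2 then (1 : L) else 0) ×
      arch (↥(maximalRealSubfield L)) L (IsCMField.complexConj L) 1 (Matrix.of fun i j : Fin 1 => if i.val + j.val + 1 = 1 then (1 : L) else 0)) :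
    IsArchStablyConjH L a b ↔
      IsConj (a.1 : GL (Fin 2) (mixedSpace L)) (b.1 : GL (Fin 2) (mixedSpace L)) ∧ IsConj (a.2 : GL (Fin 1) (mixedSpace L)) (b.2 : GL (Fin 1) (mixedSpace L)) :=
  Iff.rfl

/-- The torus point `t(z)` IS `e⁻¹ (w ↦ diag(z_w))` (★ `archPiEquivCM_archDiagTorus`). [cite: Rogawski1990, §4.9 p. 54] -/
theorem archDiagTorus_eq_symm_apply (z : {w : InfinitePlace L // IsComplex w} → Fin 2 → Circle) :
    archDiagTorus L 2 α z = (archPiEquivCM 2 L (Matrix.diagonal α)).symm (fun w => ⟨circleDiagonal 2 (z w), circleDiagonal_mem_archLocal_diagonal L 2 α w (z w)⟩) := by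
  apply (archPiEquivCM 2 L (Matrix.diagonal α)).injective
  rw [ContinuousMulEquiv.apply_symm_apply]
  funext w
  exact archPiEquivCM_archDiagTorus L 2 α z w

include hψ in
/-- **THE CLASSES OF `H_∞` IN THE STABLE CLASS OF A REGULAR TORUS POINT ARE THE FLIPS.**  For `u` regular (`u_w 0 ≠ u_w 1`) and any `δ ∈ U(Φ₁)_∞`, the conjugacy classes `c` of
`H_∞ = U(Φ₂)_∞ × U(Φ₁)_∞` with `(ψ⁻¹ t(u), δ) ∼st out c` are exactly the classes of `(ψ⁻¹ t(u^ε), δ)`, `ε : W → Bool`, `u_w^{tt} = u_w ∘ swap` — 2-block: ★ (V8) exhaustion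
`exists_isConj_archDiagTorus_of_isStablyConj` and `isStablyConj_archDiagTorus_iff_exists` read through `ψ`; 1-block: `GL₁` is commutative, so a stable conjugate has the SAME `U(Φ₁)`-component.
[cite: Rogawski1990, §3.7 Prop. 3.7.1 pp. 29–30; §4.9 p. 54; §14.3 p. 234] [cite: BorelJacquet1979, §4.1] -/
theorem setOf_isArchStablyConjH_out_eq_range (hα : ∀ i, α i ≠ 0) (hherm : ∀ i, (IsCMField.complexConj L (α i) : L) = α i)
    (u : {w : InfinitePlace L // IsComplex w} → Fin 2 → Circle) (hu : ∀ w, u w 0 ≠ u w 1)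
    (δ : arch (↥(maximalRealSubfield L)) L (IsCMField.complexConj L) 1 (Matrix.of fun i j : Fin 1 => if i.val + j.val + 1 = 1 then (1 : L) else 0)) :
    {c : ConjClasses (arch (↥(maximalRealSubfield L)) L (IsCMField.complexConj L) 2 (Matrix.of fun i j : Fin 2 => if i.val + j.val + 1 = 2 then (1 : L) else 0) ×
        arch (↥(maximalRealSubfield L)) L (IsCMField.complexConj L) 1 (Matrix.of fun i j : Fin 1 => if i.val + j.val + 1 = 1 then (1 : L) else 0)) |
          IsArchStablyConjH L (ψ.symm (archDiagTorus L 2 α u), δ) (Quotient.out c)} =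
      Set.range (fun ε : {w : InfinitePlace L // IsComplex w} → Bool =>
        ConjClasses.mk (ψ.symm (archDiagTorus L 2 α fun w => if ε w then u w ∘ ⇑(Equiv.swap (0 : Fin 2) 1) else u w), δ)) := by
  have hz : ∀ w, Function.Injective (u w) := fun w => injective_of_apply_zero_ne_apply_one _ (hu w)
  ext c
  rw [Set.mem_setOf_eq, Set.mem_range, isArchStablyConjH_iff_isConj_coe]
  constructor
  · rintro ⟨h1, h2⟩
    -- the 2-block: read through `ψ`, then ★ (V8) exhaustion
    rw [isConj_coe_iff_isConj_coe_congr L α T ψ hψ, ContinuousMulEquiv.apply_symm_apply] at h1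
    obtain ⟨ρ, hρ⟩ := exists_isConj_archDiagTorus_of_isStablyConj L 2 α hα hherm hz _ h1
    -- the 1-block: equal
    have h2' : (Quotient.out c).2 = δ := Subtype.ext (eq_of_isConj_gl_fin_one h2).symm
    refine ⟨fun w => decide (ρ w = Equiv.swap 0 1), ?_⟩
    have hρε : (fun w => if (decide (ρ w = Equiv.swap (0 : Fin 2) 1) : Bool) then u w ∘ ⇑(Equiv.swap (0 : Fin 2) 1) else u w) = fun w => u w ∘ ρ w := by
      funext w
      rcases perm_fin_two_eq_one_or_eq_swap (ρ w) with h | h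
      · rw [h]
        simp only [Equiv.Perm.coe_one, Function.comp_id]
        have : ¬ ((1 : Equiv.Perm (Fin 2)) = Equiv.swap 0 1) := by decide
        simp only [this, decide_false, Bool.false_eq_true, ↓reduceIte]
      · rw [h]
        simp only [decide_true, ↓reduceIte]
    rw [hρε]
    refine (ConjClasses.mk_eq_mk_iff_isConj.2 ?_).trans (Quotient.out_eq c)
    have h3 : IsConj (ψ.symm (archDiagTorus L 2 α fun w => u w ∘ ⇑(ρ w))) (ψ.symm (ψ (Quotient.out c).1)) :=
      ψ.symm.toMulEquiv.toMonoidHom.map_isConj hρ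
    rw [ContinuousMulEquiv.symm_apply_apply] at h3
    have hoc : Quotient.out c = ((Quotient.out c).1, δ) := Prod.ext rfl h2'
    rw [hoc, isConj_prod_iff]
    exact ⟨h3, IsConj.refl δ⟩
  · rintro ⟨ε, rfl⟩
    set z' : {w : InfinitePlace L // IsComplex w} → Fin 2 → Circle := fun w => if ε w then u w ∘ ⇑(Equiv.swap (0 : Fin 2) 1) else u w with hz'
    set c₀ : ConjClasses (arch (↥(maximalRealSubfield L)) L (IsCMField.complexConj L) 2 (Matrix.of fun i j : Fin 2 => if i.val + j.val + 1 = 2 then (1 : L) else 0) ×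
        arch (↥(maximalRealSubfield L)) L (IsCMField.complexConj L) 1 (Matrix.of fun i j : Fin 1 => if i.val + j.val + 1 = 1 then (1 : L) else 0)) :=
      ConjClasses.mk (ψ.symm (archDiagTorus L 2 α z'), δ) with hc₀
    have hc : IsConj (ψ.symm (archDiagTorus L 2 α z'), δ) (Quotient.out c₀) :=
      ConjClasses.mk_eq_mk_iff_isConj.1 (Quotient.out_eq c₀).symm
    rw [← Prod.mk.eta (p := Quotient.out c₀), isConj_prod_iff] at hc
    refine ⟨?_, ?_⟩
    · rw [isConj_coe_iff_isConj_coe_congr L α T ψ hψ, ContinuousMulEquiv.apply_symm_apply]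
      -- `t(u) ∼st t(z') ∼ ψ (out c₀).1`
      have hst : IsStablyConj (conjMixed (↥(maximalRealSubfield L)) L (IsCMField.complexConj L)) (archFormOf L 2 (Matrix.diagonal α))
          (archDiagTorus L 2 α u) (archDiagTorus L 2 α z') :=
        (isStablyConj_archDiagTorus_iff_exists L 2 α hz z').2
          ⟨fun w => if ε w then Equiv.swap 0 1 else 1, funext fun w => (comp_ite_swap_eq (u w) (ε w)).symm⟩
      have h3 : IsConj (ψ (ψ.symm (archDiagTorus L 2 α z'))) (ψ (Quotient.out c₀).1) := ψ.toMulEquiv.toMonoidHom.map_isConj hc.1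
      rw [ContinuousMulEquiv.apply_symm_apply] at h3
      exact hst.trans (isStablyConj_of_isConj h3)
    · exact (Subgroup.subtype _).map_isConj hc.2

/-- **THE `2^{#W}` FLIPPED CLASSES ARE DISTINCT**: `ε ↦ ⟦(ψ⁻¹ t(u^ε), δ)⟧` is injective for regular `u` — a conjugacy inside `U(diag α)_∞` relating two torus points preserves, place by
place, the signs `re σ_w(α_i)` of the lines carrying each eigenvalue (★ `isConj_archDiagTorus_iff_exists`), and these signs are OPPOSITE on the two lines (`hsgn`: the 2-block is a
`U(1,1)` at every place), so no flip is a conjugacy. [cite: Rogawski1990, §3.7 Prop. 3.7.1 pp. 29–30; §4.9 p. 54] [cite: BrockerTomDieck1985, Ch. IV (3.2)] -/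
theorem injective_conjClassesMk_flip (hα : ∀ i, α i ≠ 0) (hherm : ∀ i, (IsCMField.complexConj L (α i) : L) = α i)
    (hsgn : ∀ w : {w : InfinitePlace L // IsComplex w}, (w.1.embedding (α 0)).re * (w.1.embedding (α 1)).re < 0)
    (u : {w : InfinitePlace L // IsComplex w} → Fin 2 → Circle) (hu : ∀ w, u w 0 ≠ u w 1)
    (δ : arch (↥(maximalRealSubfield L)) L (IsCMField.complexConj L) 1 (Matrix.of fun i j : Fin 1 => if i.val + j.val + 1 = 1 then (1 : L) else 0)) :
    Function.Injective (fun ε : {w : InfinitePlace L // IsComplex w} → Bool =>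
      ConjClasses.mk (ψ.symm (archDiagTorus L 2 α fun w => if ε w then u w ∘ ⇑(Equiv.swap (0 : Fin 2) 1) else u w), δ)) := by
  intro ε ε' h
  have hzε : ∀ w, Function.Injective ((fun w => if ε w then u w ∘ ⇑(Equiv.swap (0 : Fin 2) 1) else u w) w) := by
    intro w
    by_cases hw : ε w
    · simp only [hw, ↓reduceIte]
      exact injective_of_apply_zero_ne_apply_one _ (comp_swap_apply_zero_ne _ (hu w))
    · simp only [hw, Bool.false_eq_true, ↓reduceIte]
      exact injective_of_apply_zero_ne_apply_one _ (hu w)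
  have h' := isConj_prod_iff.1 (ConjClasses.mk_eq_mk_iff_isConj.1 h)
  have h1 : IsConj (ψ (ψ.symm (archDiagTorus L 2 α fun w => if ε w then u w ∘ ⇑(Equiv.swap (0 : Fin 2) 1) else u w)))
      (ψ (ψ.symm (archDiagTorus L 2 α fun w => if ε' w then u w ∘ ⇑(Equiv.swap (0 : Fin 2) 1) else u w))) :=
    ψ.toMulEquiv.toMonoidHom.map_isConj h'.1
  rw [ContinuousMulEquiv.apply_symm_apply, ContinuousMulEquiv.apply_symm_apply] at h1
  obtain ⟨ρ, hρ, hsign⟩ := (isConj_archDiagTorus_iff_exists L 2 α hα hherm hzε _).1 h1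
  funext w
  -- `ρ_w = 1`: a flip would exchange a positive and a negative line
  have hρ1 : ρ w = 1 := by
    rcases perm_fin_two_eq_one_or_eq_swap (ρ w) with h0 | h0
    · exact h0
    · exfalso
      have hs := hsign w 0
      rw [h0, Equiv.swap_apply_left] at hs
      rcases mul_neg_iff.1 (hsgn w) with ⟨ha, hb⟩ | ⟨ha, hb⟩
      · exact absurd (hs.2 ha) (not_lt.2 hb.le)
      · exact absurd (hs.1 hb) (not_lt.2 ha.le)
  have hρw := congrFun hρ w
  simp only [hρ1, Equiv.Perm.coe_one, Function.comp_id] at hρw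
  -- compare the two flips at `w`: a mismatch would force `u_w ∘ swap = u_w`
  revert hρw
  cases ε w <;> cases ε' w <;> intro hρw
  · rfl
  · exfalso
    simp only [Bool.false_eq_true, ↓reduceIte] at hρw
    have h10 := congrFun hρw 0
    simp only [Function.comp_apply, Equiv.swap_apply_left] at h10
    exact hu w h10.symm
  · exfalso
    simp only [Bool.false_eq_true, ↓reduceIte] at hρw
    have h10 := congrFun hρw 0
    simp only [Function.comp_apply, Equiv.swap_apply_left] at h10
    exact hu w h10
  · rfl

end Classes


end UnitaryGroup

end Literature.NumberTheory.Automorphic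

end
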